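import Literature.IUT.LogVolume.Corollary22FullGaloisImage
import Literature.IUT.LogVolume.Corollary22ThetaFieldExists
import Literature.NumberTheory.DiophantineGeometry.GenEllGaloisImageTwist
import HarnessLib

/-!
# [IUTchIV] Cor. 2.2 (ii) (P6) ⟹ Thm. 1.10's setting: `SL₂(𝔽_l) ⊆` Galois image for EVERY model of `E` over
# every Galois extension of `F_tpd` of degree prime to `l` — from `Cor22.CondP6` unchanged

Mochizuki, *Inter-universal Teichmüller theory IV*, RIMS manuscript (Apr. 2020; = PRIMS **57** (2021)).
Cor. 2.2 (ii), proof, (P6) p. 46: "the image of the outer homomorphism `Gal(Q̄/F) → GL₂(𝔽_l)` determined by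
the `l`-torsion points of `E_F` contains the subgroup `SL₂(𝔽_l) ⊆ GL₂(𝔽_l)`", for `E_F` the Legendre curve of
`x_E = λ` over the theta-field `F = F_tpd(√−1, E_{F_tpd}[3·5])` (p. 42) — the tree's interface `Cor22.CondP6 P l`
(`Corollary22Legendre.lean`), the hypothesis of `Cor22.Thm110Legendre`.  (P7) p. 46 then takes "the “`X_F`” of
[IUTchI], Definition 3.1, to be the once-punctured elliptic curve associated to `E_F`" and invokes Thm. 1.10,
whose setting (p. 22) builds the initial Θ-data on a model `E_F ≅ W ×_{F_mod} F` of "ANY model of `E_F ×_F F̄`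
over `F_mod`" (Prop. 1.8 (ii), (iii): `Aut(E) = {±1}` as `E_F` admits an `F`-core, p. 43, so `j ∉ {0, 1728}`)
over `F = F_mod(√−1, E_{F_mod}[2·3·5])`, with `Gal(F/F_tpd) ↪ GL₂(𝔽₃) × GL₂(𝔽₅) × ℤ/2ℤ` (so `[F : F_tpd]` is
prime to `l ≥ 7`) and [IUTchI] Def. 3.1 (c) asking for `SL₂(𝔽_l) ⊆` the image of `Gal(F̄/F)` on THAT curve's
`l`-torsion.  In the cell's (P7)-constructor (`InitialThetaDataOfModel*`, abc-iut-L5-t7) this is the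
hypothesis `BadPlaceInput.imageContainsSL2` for `(ThetaF W, modelCurve W)` — a TWIST of the Legendre curve over
a DIFFERENT Galois extension of `F_tpd`.

PROOF-ONLY file (theorems only, no definitions, no named facts).  It PROVES that `Cor22.CondP6 P l` as typed
already yields (P6) in every such setting (`imageModLContainsSL2_of_condP6`): for `λ ∈ U_X` admitting a core
(`Cor22.AdmitsCore`, `j(λ) ∉ {0, 1728}`), a prime `l ≥ 5`, any number field `F′ ⊇ F_tpd` Galois over `F_tpd`
with `l ∤ [F′ : F_tpd]`, and any elliptic curve `E/F′` with `j(E) = j(λ)`, every determinant-one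
`𝔽_l`-linear endomorphism of `E[l](F̄′)` is a Galois element.  Chain (all classical, in the tree): a theta-field
`F` exists (`Cor22.exists_isThetaField`, abc-iut-S-d1) ⟶ (P6) there (`CondP6`) ⟶ DOWN to `F_tpd`
(`EllPoint.imageModLContainsSL2_of_baseChange`) ⟶ UP to `F′`
(`EllPoint.imageModLContainsSL2_map_of_isGalois_of_not_dvd`: `l ∤ [F′:F_tpd]`) ⟶ across the quadratic twist
(`EllPoint.imageModLContainsSL2_of_j_eq`: `j ∉ {0,1728}`, `l ≠ 2`).  Also the threshold form of the whole
classical input (P4) ⟹ (P6) in this generality (`condP6_model_of_seven_le`, from `Cor22.condP6_of_seven_le`),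
and the converse bookkeeping (P6) ⟹ (P4) "`E` admits no `l`-cyclic subgroup scheme"
(`EllPoint.not_admitsLCyclic_of_imageModLContainsSL2`: `SL₂(𝔽_l)` moves every line of `E[l]`), so that the
cell's (P7)-constructor `exists_initialThetaData_of_conditions` (abc-iut-L5-t7, hypothesis
`hno : ¬ AdmitsLCyclic`) is fed from `CondP6` as well (`not_admitsLCyclic_of_condP6`).
So NEITHER `Cor22.Thm110Legendre` NOR the tree's proof of Cor. 2.2 (ii) from it
(`Cor22.partII_of_thm110Legendre`) needs a restated (P6) to feed the (P7)-constructor.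
TAKES NO SIDE on [IUTchIII] Cor. 3.12 (not mentioned); nothing here is specific to IUT beyond the locators.
-/

noncomputable section

open scoped Classical

namespace Literature.NumberTheory.DiophantineGeometry.GenEll.EllPoint

open Module

/-- **(P6) ⟹ (P4)**: if the image of `Gal(F̄/F)` on `E[l]` contains `SL₂(𝔽_l)` then `E` admits no `l`-cyclic
subgroup scheme (no `Γ_F`-stable subgroup of `E[l]` of order `l`): for a stable line `H = 𝔽_l·v` and `w ∉ H`
the determinant-one map `v ↦ v + w`, `w ↦ w` is a Galois element moving `v` out of `H` ([IUTchIV] Cor. 2.2,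
(P4) vs (P6), pp. 45–46; [GenEll] Lem. 3.1). [cite: Mochizuki2012, IUTchIV Cor. 2.2 proof (P4)(P6) pp.45–46] -/
theorem not_admitsLCyclic_of_imageModLContainsSL2 (P : EllPoint) (l : ℕ) [Fact l.Prime]
    (h : P.ImageModLContainsSL2 l) : ¬ P.AdmitsLCyclic l := by
  classical
  rintro ⟨H, hstab, hcard⟩
  have hl : l.Prime := Fact.out
  letI : Module (ZMod l) (P.W.geomTorsion (l : ℤ)) := AddSubgroup.torsionBy.zmodModule
  have hA := P.finrank_geomTorsion_eq_two l
  haveI : Module.Finite (ZMod l) (P.W.geomTorsion (l : ℤ)) := Module.finite_of_finrank_eq_succ hA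
  -- `H` as an `𝔽_l`-subspace
  set S : Submodule (ZMod l) (P.W.geomTorsion (l : ℤ)) := AddSubgroup.toZModSubmodule l H with hS
  have hSH : (S : Set (P.W.geomTorsion (l : ℤ))) = H := AddSubgroup.coe_toZModSubmodule l H
  have hmemS : ∀ x : P.W.geomTorsion (l : ℤ), x ∈ S ↔ x ∈ H := fun x => by
    rw [← SetLike.mem_coe, hSH, SetLike.mem_coe]
  -- a nonzero `v ∈ H`
  have hv : ∃ v ∈ H, v ≠ 0 := by
    by_contra hcon
    push Not at hcon
    have hbot : H = ⊥ := (AddSubgroup.eq_bot_iff_forall _).mpr hcon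
    rw [hbot, AddSubgroup.card_bot] at hcard
    exact hl.one_lt.ne hcard
  obtain ⟨v, hvH, hv0⟩ := hv
  -- some `w ∉ H` (`#H = l < l² = #E[l]`)
  have hw : ∃ w : P.W.geomTorsion (l : ℤ), w ∉ H := by
    by_contra hcon
    push Not at hcon
    have htop : H = ⊤ := (AddSubgroup.eq_top_iff' H).mpr hcon
    have hcardV : Nat.card (P.W.geomTorsion (l : ℤ)) = l ^ 2 := P.natCard_geomTorsion_eq_sq l
    rw [htop, AddSubgroup.card_top, hcardV] at hcard
    have : l ^ 2 = l ^ 1 := by rw [hcard, pow_one]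
    exact absurd (Nat.pow_right_injective hl.two_le this) (by norm_num)
  obtain ⟨w, hwH⟩ := hw
  -- `(v, w)` is a basis of `E[l]`
  have hli : LinearIndependent (ZMod l) ![v, w] := by
    rw [LinearIndependent.pair_iff]
    intro s t hst
    by_cases ht : t = 0
    · rw [ht, zero_smul, add_zero, smul_eq_zero] at hst
      exact ⟨hst.resolve_right hv0, ht⟩
    · exfalso
      apply hwH
      have hw_eq : w = -(t⁻¹ * s) • v := by
        have h1 : t • w = -(s • v) := eq_neg_of_add_eq_zero_right hst
        calc w = t⁻¹ • (t • w) := by rw [smul_smul, inv_mul_cancel₀ ht, one_smul]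
          _ = -(t⁻¹ * s) • v := by rw [h1, smul_neg, smul_smul, neg_smul]
      rw [← hmemS, hw_eq]
      exact S.smul_mem _ ((hmemS v).mpr hvH)
  have hcardι : Fintype.card (Fin 2) = finrank (ZMod l) (P.W.geomTorsion (l : ℤ)) := by
    rw [Fintype.card_fin, hA]
  set b : Basis (Fin 2) (ZMod l) (P.W.geomTorsion (l : ℤ)) :=
    basisOfLinearIndependentOfCardEqFinrank hli hcardι with hb
  have hb0 : b 0 = v := by
    rw [hb, coe_basisOfLinearIndependentOfCardEqFinrank]; rfl
  have hb1 : b 1 = w := by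
    rw [hb, coe_basisOfLinearIndependentOfCardEqFinrank]; rfl
  -- the transvection `v ↦ v + w`, `w ↦ w`
  set M : Matrix (Fin 2) (Fin 2) (ZMod l) := !![1, 0; 1, 1] with hM
  set f : P.W.geomTorsion (l : ℤ) →ₗ[ZMod l] P.W.geomTorsion (l : ℤ) := Matrix.toLin b b M with hf
  have hfdet : LinearMap.det f = 1 := by
    rw [hf, LinearMap.det_toLin, hM, Matrix.det_fin_two_of]; ring
  have hfv : f v = v + w := by
    rw [← hb0, hf, Matrix.toLin_self, Fin.sum_univ_two, hb0, hb1, hM]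
    simp
  obtain ⟨σ, hσ⟩ := h f hfdet
  have h1 : σ • v ∈ H := hstab σ v hvH
  rw [hσ v, hfv] at h1
  exact hwH (by simpa using H.sub_mem h1 hvH)

end Literature.NumberTheory.DiophantineGeometry.GenEll.EllPoint

namespace Literature.IUT.LogVolume

namespace Cor22

open NumberField Literature.NumberTheory.DiophantineGeometry.GenEll
open Literature.NumberTheory.EllipticCurves WeierstrassCurve

/-- `j(λ) ≠ 0` and `j(λ) ≠ 1728` when the once-punctured elliptic curve admits a core (p. 43: the four
exceptional `j`-invariants include `1728 = 2⁶·3³` and `0`). [cite: Mochizuki2012, IUTchIV Cor. 2.2 proof p.43] -/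
theorem jInv_ne_zero_and_ne_1728_of_admitsCore {P : NFPoint} (hcore : AdmitsCore P) :
    jInv P.x ≠ 0 ∧ jInv P.x ≠ 1728 := by
  constructor
  · have h := hcore 0 (by simp [coreExceptionalJ])
    simpa using h
  · have h := hcore 1728 (by simp [coreExceptionalJ])
    intro h'
    apply h
    rw [h']
    norm_num

/-- **(P6) of Cor. 2.2 (ii) ⟹ (P6) for every model over every Galois extension of `F_tpd` of degree prime to
`l`** ([IUTchIV] Cor. 2.2 (P6) p. 46 ⟹ the `SL₂(𝔽_l)`-condition of [IUTchI] Def. 3.1 (c) in the setting of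
Thm. 1.10 p. 22, where `E_F` is a model `W ×_{F_mod} F` of a twist and `[F : F_tpd] ∣ 2·|GL₂(𝔽₂)|·|GL₂(𝔽₃)|·
|GL₂(𝔽₅)|` is prime to `l ≥ 7`): for `λ ∈ U_X` with `Cor22.AdmitsCore P` (`j ∉ {0,1728}`), a prime `l ≥ 5`
with `Cor22.CondP6 P l`, a number field `F′`, Galois over `F_tpd = P.F` with `l ∤ [F′ : F_tpd]`, and an
elliptic curve `E` over `F′` with `j(E) = j(λ)`: the image of `Gal(F̄′/F′)` on `E[l]` contains `SL₂(𝔽_l)`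
(`EllPoint.ImageModLContainsSL2 ⟨F′, E⟩ l`). [cite: Mochizuki2012, IUTchIV Cor. 2.2 (ii) (P6)–(P7) p.46] -/
theorem imageModLContainsSL2_of_condP6 {P : NFPoint} (hU : P.InU) (hcore : AdmitsCore P)
    {l : ℕ} [Fact l.Prime] (h5 : 5 ≤ l) (h6 : CondP6 P l)
    (F' : Type) [Field F'] [NumberField F'] [Algebra P.F F'] [IsGalois P.F F']
    (hcop : ¬ l ∣ Module.finrank P.F F') (E : WeierstrassCurve F') [E.IsElliptic]
    (hj : E.j = algebraMap P.F F' (jInv P.x)) :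
    ({ F := F', W := E } : EllPoint).ImageModLContainsSL2 l := by
  have hl2 : l ≠ 2 := by omega
  -- the Legendre curve over `F_tpd`
  haveI hE₀ : P.legendreCurve.IsElliptic := P.legendreCurve_isElliptic_iff.2 hU
  have hj₀ : P.legendreCurve.j = jInv P.x := j_legendre P hU
  -- a theta-field `F`, where (P6) is given
  obtain ⟨F, hNF, hF⟩ := exists_isThetaField (P := P) hU
  haveI := hNF
  haveI hEF : (thetaCurve P F).IsElliptic := thetaCurve_isElliptic hU F
  have h1 : (thetaEllPoint P hU F).ImageModLContainsSL2 l := h6 hU F hF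
  -- the theta-curve IS the base change of the Legendre curve over `F_tpd`
  have hmap : (1 : VariableChange F) • thetaCurve P F = P.legendreCurve.map (algebraMap P.F F) := by
    rw [one_smul]
    ext <;> simp [NFPoint.legendreCurve]
  have h2 : ({ F := (F : Type), W := P.legendreCurve.map (algebraMap P.F F) } : EllPoint).ImageModLContainsSL2 l :=
    EllPoint.imageModLContainsSL2_of_variableChange_eq (K := (F : Type)) 1 hmap l h1
  -- DOWN to `F_tpd`
  have h3 : ({ F := P.F, W := P.legendreCurve } : EllPoint).ImageModLContainsSL2 l :=
    EllPoint.imageModLContainsSL2_of_baseChange ({ F := P.F, W := P.legendreCurve } : EllPoint) F l h2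
  -- UP to `F'`
  have h4 : ({ F := F', W := P.legendreCurve.map (algebraMap P.F F') } : EllPoint).ImageModLContainsSL2 l :=
    EllPoint.imageModLContainsSL2_map_of_isGalois_of_not_dvd
      ({ F := P.F, W := P.legendreCurve } : EllPoint) F' l hcop h3
  -- across the twist
  obtain ⟨hj0, hj1728⟩ := jInv_ne_zero_and_ne_1728_of_admitsCore hcore
  have hjmap : (P.legendreCurve.map (algebraMap P.F F')).j = E.j := by
    rw [map_j, hj₀, hj]
  have h0' : (P.legendreCurve.map (algebraMap P.F F')).j ≠ 0 := by
    rw [map_j, hj₀]; exact (map_ne_zero_iff _ (algebraMap P.F F').injective).mpr hj0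
  have h1728' : (P.legendreCurve.map (algebraMap P.F F')).j ≠ 1728 := by
    rw [map_j, hj₀]
    intro h
    apply hj1728
    apply (algebraMap P.F F').injective
    rw [h, map_ofNat]
  exact EllPoint.imageModLContainsSL2_of_j_eq (P.legendreCurve.map (algebraMap P.F F')) E hjmap h0' h1728'
    l hl2 h4

/-- **`Cor22.CondP6 P l` ⟹ (P4) for every model over every Galois extension of `F_tpd` of degree prime to
`l`**: under the hypotheses of `imageModLContainsSL2_of_condP6`, `E` admits no `l`-cyclic subgroup scheme —
the hypothesis `hno` of the cell's (P7)-constructor `exists_initialThetaData_of_conditions` for the model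
`(F_mod(√−1, W[2·3·5]), W ⊗ F)` of Thm. 1.10 p. 22. [cite: Mochizuki2012, IUTchIV Cor. 2.2 (ii) (P4)–(P7) pp.45–46] -/
theorem not_admitsLCyclic_of_condP6 {P : NFPoint} (hU : P.InU) (hcore : AdmitsCore P)
    {l : ℕ} [Fact l.Prime] (h5 : 5 ≤ l) (h6 : CondP6 P l)
    (F' : Type) [Field F'] [NumberField F'] [Algebra P.F F'] [IsGalois P.F F']
    (hcop : ¬ l ∣ Module.finrank P.F F') (E : WeierstrassCurve F') [E.IsElliptic]
    (hj : E.j = algebraMap P.F F' (jInv P.x)) :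
    ¬ ({ F := F', W := E } : EllPoint).AdmitsLCyclic l :=
  EllPoint.not_admitsLCyclic_of_imageModLContainsSL2 _ l
    (imageModLContainsSL2_of_condP6 hU hcore h5 h6 F' hcop E hj)

/-- **The classical input (P4) ⟹ (P6) of Cor. 2.2 (ii), in the generality of Thm. 1.10's setting** (threshold
form): for every compactly bounded `K_V` there is `H_K` (the one of `Cor22.condP6_of_seven_le`, i.e. of
`Cor22.FullGaloisImage`) such that for `λ ∈ K_V ∩ U_X` (minimally presented) admitting a core, primes `l ≥ 7` with (P2), (P5) and
`H_K < log(q^∀(λ))`, EVERY elliptic curve `E` with `j(E) = j(λ)` over EVERY Galois extension `F′/F_tpd` with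
`l ∤ [F′:F_tpd]` has `SL₂(𝔽_l) ⊆` the image of `Gal(F̄′/F′)` on `E[l]`.
[cite: Mochizuki2012, IUTchIV Cor. 2.2 (ii) (P4)–(P6) pp.45–46] -/
theorem condP6_model_of_seven_le (D : CBData) :
    ∃ HK : ℝ, ∀ P : NFPoint, P ∈ D.toSet → P ∈ UP → AdmitsCore P → ∀ l : ℕ, [Fact l.Prime] → 7 ≤ l →
      CondP2 P l → CondP5 P l → HK < logQForall P →
        ∀ (F' : Type) [Field F'] [NumberField F'] [Algebra P.F F'] [IsGalois P.F F'],
          ¬ l ∣ Module.finrank P.F F' → ∀ (E : WeierstrassCurve F') [E.IsElliptic],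
            E.j = algebraMap P.F F' (jInv P.x) → ({ F := F', W := E } : EllPoint).ImageModLContainsSL2 l := by
  obtain ⟨HK, hHK⟩ := condP6_of_seven_le D
  refine ⟨HK, fun P hPD hUP hcore l _ h7 hP2 hP5 hh F' _ _ _ _ hcop E _ hj => ?_⟩
  have hl : l.Prime := Fact.out
  exact imageModLContainsSL2_of_condP6 hUP.1 hcore (by omega) (hHK P hPD hUP l hl h7 hP2 hP5 hh) F' hcop E hj

end Cor22

end Literature.IUT.LogVolume

end
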